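import Literature.MathematicalPhysics.QuantumFieldTheory.Balaban1983to89.B7Eq170General
import Literature.MathematicalPhysics.QuantumFieldTheory.Balaban1983to89.B7Prop8Flat

/-!
# `Balaban1983to89.B7Prop8General` — T. Bałaban, *Averaging operations for lattice gauge theories*, Commun. Math. Phys.
**98** (1985) 17–51 [Balaban1985Averaging], Sect. F, Proposition 8 and (171)–(175) p. 45 AT A GENERAL (curved) UNITARY
BACKGROUND `U₀` — kernel form over the concrete model, with the explicit constants of `B7Prop8Flat`

statement-level skeleton of published theorems with citation tags; proofs where landed; nothing here is a claim about the Yang–Mills mass gap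

PDF held: `paper:balaban1985-cmp98-averaging` (journal page = PDF page + 16); renders `…/1985-cmp98-averaging-p028/p029-x2.png`.

CITATION HEADER (lean-in-tree rule).  lit-balaban SKELETON rows `B7.Prop8` / `B7.Eq171` (PHASE2 nomination of unit r04).
PRINT (p. 45, verbatim; quoted in full in the module docstring of `B7Prop8Flat`): "Now let us take two gauge transformations
`u₁, u₂` satisfying (166), (167). Applying the above result [(170)] to `u = u₁u₂`, we get `(R̄₀u)(x₁) = (R̄₀u₁)(x₁)(R̄₀u₂)(x₁)e^{ir₁(x₁)},
|r₁(x₁)| < C₃(α₃Lη)²` (171) … We can prove by an easy induction that `(R̄₀uʲ)(x_j) = (R̄₀u₁ʲ)(x_j)(R̄₀u₂ʲ)(x_j)e^{ir_j(x_j)},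
x_j ∈ Ω^{(j)}, |r_j(x_j)| < … < 2C₃(α₃Lʲη)²` (173) for `α₃` sufficiently small … (175) … **Proposition 8.** If
`u₁, u₂ ∈ Λ_k(U₀, α₃)` and `α₃` is sufficiently small, i.e., `α₃ ≦ c₆` for some `c₆`, then `u = u₁u₂ ∈ Λ_k(U₀, 2α₃ + 2C₃α₃²)`
and we have (173)."

WHAT THIS FILE PROVES.  `B7Prop8Flat` kernel-checks (171)–(175) and Proposition 8 at the FLAT background `U₀ = 1` only (its
reading (d): "in the Banach reading the curved case would need the (108)-machinery …").  Print's proof (pp. 44–45) is written for a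
general background and uses only that the rotations `R̄ʲ_{0,x_{j+1}}` by the transporters of the averaged backgrounds `Ū₀ʲ` are
ISOMETRIES.  This file makes exactly that precise: over a C⋆-algebra `𝔸` (e.g. `M_N(ℂ)` with the operator norm (19)), for a
background `U₀ : ℤ^d → (Fin d → 𝔸ˣ)` whose averaged backgrounds `Ū₀ʲ = B7Prop2Explicit.avgIter L U₀ j`, `j < k`, are
UNITARY-valued (hypothesis `hV`; for unitary `U₀` with the regularity (52) this is `B7Prop2Explicit.prop2_unitaryUnits`), and
gauge transformations `u₁, u₂ ∈ Λ_k(U₀, α₃)` (`B7Eq167Flat.InLambda L U₀ uᵢ k α₃ η`, the class (166)–(167) AT `U₀`, with the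
general-background averages (79)–(80) `B7Eq84Concrete.uavg L U₀ u j = \overline{R₀u}ʲ`):
* **`eq173_general`** — (171)–(173): `\overline{R₀u}ʲ = \overline{R₀u₁}ʲ·\overline{R₀u₂}ʲ·e^{r_j}`, `‖r_j‖ ≤ 2·1116·(α₃Lʲη)²`
  for all `j ≤ k` (`u = u₁u₂`), by the printed induction, the step being the general-background product lemma
  `B7Eq170General.eq170_general'` at `V₀ = Ū₀ʲ` (hypotheses: (167) at `U₀` verbatim = `cond167_iff_R0fun`; the rotated phase
  bound `‖(R̄ʲ_{0,y}r_j)(x)‖ = ‖r_j(x)‖` by unitarity, `B7Eq170General.norm_R0lie_of_unitary`) and the arithmetic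
  `B7Prop8Flat.step173_arith`;
* **`cond166_mul`, `cond167_mul`, `prop8_general`, `prop8_general'`** — (175) and Proposition 8 AT `U₀`:
  `u₁u₂ ∈ Λ_k(U₀, 6α₃ + 8928α₃²) ⊆ Λ_k(U₀, 10α₃)` for `L ≥ 2`, `0 ≤ η`, `L^kη ≤ 1`, `0 ≤ α₃ ≤ 1/3000` — the SAME explicit
  constants as `B7Prop8Flat.prop8_flat` (print: `2α₃ + 2C₃α₃²`; the factors are the Banach bookkeeping of `B7Prop8Flat`
  reading (a), unchanged), the factorisation (168) of the (167)-quantity for `u₁u₂` being read on the rotated data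
  (`B7Eq170General.R0fun_vprod` + `B7Eq170Flat.eq168_factor`).
READINGS: (a)–(c), (e), (f) of `B7Prop8Flat` verbatim; (d) is REPLACED by the unitarity hypothesis `hV` on the level
backgrounds (print: `G ⊂ U(N)`, so automatic there).  At `U₀ = 1` (`avgIter_one`, unitary) this file's theorems specialise to
`B7Prop8Flat`'s.  NOT CLAIMED: print's unstated `c₆`, `C₃`; the abstract-carrier statement `B7.Prop8Printed` is not
instantiated here (different interface; row B7.Prop8 keeps it as the citation statement).  Unit `lit-balaban-r04` (gen 2), 2026-08-20.
-/

noncomputable section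

open NormedSpace Finset

namespace Literature.MathematicalPhysics.QuantumFieldTheory.Balaban1983to89.B7Prop8General

open B7Prop1Explicit MatrixLog B7Prop2Explicit B7Eq92Concrete B7Eq99Concrete B7Eq84Concrete B7Eq167Flat B7Eq170Flat
  B7Eq170General B7Prop8Flat
open B7Prop6Flat (norm_units_inv_sub_one_le)

export B7Prop1Explicit (Site)

variable {d : ℕ}

/-! ## §1 (167) at a general background is the hypothesis of the product lemma -/

section General

variable {𝔸 : Type*} [NormedRing 𝔸] [NormedAlgebra ℂ 𝔸] [CompleteSpace 𝔸]

/-- **(167) at the background `U₀`** reads, level by level, `‖(ūʲ)⁻¹(y)(R̄ʲ_{0,y}ūʲ)(x) − 1‖ ≤ α₃L^{j+1}η` with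
`y = Lx_{j+1}`, `x = y + r ∈ B(y)` and the rotation `R̄ʲ_{0,y} = B7Eq99Concrete.R0fun (Ū₀ʲ) y` — exactly the hypothesis
"`|v_i⁻¹(y)(R_{0,y}v_i)(x) − 1| < c₂`" of the product lemma p. 44 with `V₀ = Ū₀ʲ`, `v = ūʲ`, `c₂ = α₃L^{j+1}η`.
[cite: Balaban1985Averaging, (167) p.44, (79)–(80) p.30] -/
theorem cond167_iff_R0fun (L : ℕ) (U₀ : Site d → Fin d → 𝔸ˣ) (u : Site d → 𝔸ˣ) (k : ℕ) (α₃ η : ℝ) :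
    Cond167 L U₀ u k α₃ η ↔
      ∀ j < k, ∀ (z : Site d) (r : Fin d → Fin L),
        ‖((((uavg L U₀ u j ((L : ℤ) • z))⁻¹ *
            R0fun (avgIter L U₀ j) ((L : ℤ) • z) (uavg L U₀ u j) ((L : ℤ) • z + boxVec L r) : 𝔸ˣ)) : 𝔸) - 1‖
          ≤ α₃ * (L : ℝ) ^ (j + 1) * η := by
  simp only [Cond167, R0fun_add]

/-- At level `0`: `ū⁰ = u = u₁u₂ = ū₁⁰ū₂⁰e^{i·0}` (`r₀ = 0`), at any background. [cite: Balaban1985Averaging, (79) p.30, (171) p.45] -/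
theorem uavg_mul_zero (L : ℕ) (U₀ : Site d → Fin d → 𝔸ˣ) (u₁ u₂ : Site d → 𝔸ˣ) :
    uavg L U₀ (u₁ * u₂) 0 = vprod (uavg L U₀ u₁ 0) (uavg L U₀ u₂ 0) (fun _ => (0 : 𝔸)) := by
  funext x
  simp only [uavg_zero, Pi.mul_apply, vprod_apply, expUnit_zero, mul_one]

/-- The rotated data have the same values at the centre: `v₁v₂e^{r}` and `(R_{0,y}v₁)(R_{0,y}v₂)e^{R_{0,y}r}` agree at `y`.
[cite: Balaban1985Averaging, (168) p.44] -/
theorem vprod_R0fun_self (V₀ : Site d → Fin d → 𝔸ˣ) (y : Site d) (v₁ v₂ : Site d → 𝔸ˣ) (r : Site d → 𝔸) :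
    vprod (R0fun V₀ y v₁) (R0fun V₀ y v₂) (R0lie V₀ y r) y = vprod v₁ v₂ r y := by
  simp only [vprod_apply, R0fun_self, R0lie_self]

end General

/-! ## §2 (171)–(173) at a general unitary background -/

section Unitary

variable {𝔸 : Type*} [CStarAlgebra 𝔸]
variable {L : ℕ} {U₀ : Site d → Fin d → 𝔸ˣ} {u₁ u₂ : Site d → 𝔸ˣ} {k : ℕ} {α₃ η : ℝ}

/-- **(171)–(173) at a general unitary background, kernel form** ("We can prove by an easy induction that
`(R̄₀uʲ)(x_j) = (R̄₀u₁ʲ)(x_j)(R̄₀u₂ʲ)(x_j)e^{ir_j(x_j)}, x_j ∈ Ω^{(j)}, |r_j(x_j)| < … < 2C₃(α₃Lʲη)²` (173)"): for a background `U₀`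
whose averaged backgrounds `Ū₀ʲ`, `j < k`, are unitary-valued, `u₁, u₂ ∈ Λ_k(U₀, α₃)` (`B7Eq167Flat.InLambda`), `L ≥ 2`, `0 ≤ η`,
`0 ≤ α₃ ≤ 1/5` and `α₃L^kη ≤ 1/3000`, every `j ≤ k` admits `r_j : ℤ^d → 𝔸` with `\overline{R₀(u₁u₂)}ʲ = \overline{R₀u₁}ʲ·\overline{R₀u₂}ʲ·e^{r_j}`
and `‖r_j‖ ≤ 2·1116·(α₃Lʲη)²`; `r₀ = 0`, `r_{j+1}(x_{j+1}) = r̄(Lx_{j+1})` is the general-background `r̄` of (169)–(170)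
(`B7Eq170General.rbarGen` at `V₀ = Ū₀ʲ`). [cite: Balaban1985Averaging, (171)–(173) p.45, (170) p.45] -/
theorem eq173_general (hV : ∀ j < k, ∀ (x : Site d) (κ : Fin d), ((avgIter L U₀ j x κ : 𝔸ˣ) : 𝔸) ∈ unitary 𝔸)
    (hL : 2 ≤ L) (hη : 0 ≤ η) (hα0 : 0 ≤ α₃) (hα : α₃ ≤ 1 / 5)
    (ht : α₃ * (L : ℝ) ^ k * η ≤ 1 / 3000)
    (h₁ : InLambda L U₀ u₁ k α₃ η) (h₂ : InLambda L U₀ u₂ k α₃ η) :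
    ∀ j ≤ k, ∃ r : Site d → 𝔸,
      uavg L U₀ (u₁ * u₂) j = vprod (uavg L U₀ u₁ j) (uavg L U₀ u₂ j) r ∧
        ∀ z, ‖r z‖ ≤ 2 * 1116 * (α₃ * (L : ℝ) ^ j * η) ^ 2 := by
  have hL1 : 1 ≤ L := le_trans (by norm_num) hL
  have hLr : (1 : ℝ) ≤ L := by exact_mod_cast hL1
  have hLr2 : (2 : ℝ) ≤ L := by exact_mod_cast hL
  have h167₁ := (cond167_iff_R0fun L U₀ u₁ k α₃ η).1 h₁.2
  have h167₂ := (cond167_iff_R0fun L U₀ u₂ k α₃ η).1 h₂.2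
  have h166₂ := h₂.1
  have hmono : ∀ j ≤ k, α₃ * (L : ℝ) ^ j * η ≤ α₃ * (L : ℝ) ^ k * η := fun j hj =>
    mul_le_mul_of_nonneg_right (mul_le_mul_of_nonneg_left (pow_le_pow_right₀ hLr hj) hα0) hη
  intro j
  induction j with
  | zero =>
    intro _
    exact ⟨fun _ => 0, uavg_mul_zero L U₀ u₁ u₂, fun z => by rw [norm_zero]; positivity⟩
  | succ j ih =>
    intro hjk
    obtain ⟨r, hE, hB⟩ := ih (Nat.le_of_succ_le hjk)
    have hjlt : j < k := Nat.lt_of_succ_le hjk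
    set b : ℝ := α₃ * (L : ℝ) ^ j * η with hb
    set a : ℝ := α₃ * (L : ℝ) ^ (j + 1) * η with ha
    have hb0 : 0 ≤ b := by rw [hb]; positivity
    have hab : a = (L : ℝ) * b := by rw [ha, hb, pow_succ]; ring
    have ha' : a ≤ 1 / 3000 := (hmono (j + 1) hjk).trans ht
    have hbk : b ≤ 1 / 3000 := (hmono j hjlt.le).trans ht
    set c₁ : ℝ := 2 * 1116 * b ^ 2 with hc₁
    have hc₁0 : 0 ≤ c₁ := by rw [hc₁]; positivity
    have hc₁s : c₁ ≤ 1 / 400 := by rw [hc₁]; nlinarith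
    have hc₂s : a ≤ 1 / 400 := by linarith
    -- the level-`j` background and its unitarity
    set V : Site d → Fin d → 𝔸ˣ := avgIter L U₀ j with hVdef
    have hVu : ∀ (x : Site d) (κ : Fin d), ((V x κ : 𝔸ˣ) : 𝔸) ∈ unitary 𝔸 := fun x κ => hV j hjlt x κ
    -- the product lemma at `V₀ = Ū₀ʲ`, `y = Lz`
    have hy : ∀ z : Site d,
        R0avg L V (vprod (uavg L U₀ u₁ j) (uavg L U₀ u₂ j) r) ((L : ℤ) • z) =
            R0avg L V (uavg L U₀ u₁ j) ((L : ℤ) • z) * R0avg L V (uavg L U₀ u₂ j) ((L : ℤ) • z) *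
              expUnit (rbarGen L V (uavg L U₀ u₁ j) (uavg L U₀ u₂ j) r ((L : ℤ) • z)) ∧
          ‖rbarGen L V (uavg L U₀ u₁ j) (uavg L U₀ u₂ j) r ((L : ℤ) • z)‖ ≤ c₁ + 1116 * (c₁ + a) ^ 2 := by
      intro z
      refine eq170_general' (L := L) (V₀ := V) (v₁ := uavg L U₀ u₁ j) (v₂ := uavg L U₀ u₂ j) (r := r)
        (y := (L : ℤ) • z) (c₁ := c₁) (c₂ := a) (hB _) ?_ (fun ρ => h167₁ j hjlt z ρ) (fun ρ => h167₂ j hjlt z ρ)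
        ((norm_units_inv_sub_one_le _ ((h166₂ j hjlt.le _).trans (by linarith))).trans
          (by linarith [h166₂ j hjlt.le ((L : ℤ) • z)]))
        ((h166₂ j hjlt.le _).trans (by linarith)) hL1 hc₁s hc₂s
      intro ρ
      rw [norm_R0lie_of_unitary V hVu]
      exact hB _
    refine ⟨fun z => rbarGen L V (uavg L U₀ u₁ j) (uavg L U₀ u₂ j) r ((L : ℤ) • z), ?_, ?_⟩
    · funext z
      rw [uavg_succ, hE, ← hVdef, (hy z).1, vprod_apply, uavg_succ, uavg_succ]
    · intro z
      exact (hy z).2.trans (step173_arith hLr2 hb0 hab ha' hc₁0 le_rfl)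

/-! ## §3 (175) and Proposition 8 at a general unitary background -/

/-- **(175), first line, at the background `U₀`** ("`|(R̄₀uʲ)(x_j) − 1| < 2α₃ + 2C₃(α₃Lʲη)² ≦ 2α₃ + 2C₃α₃², j = 0, 1, …, k`"):
`‖ū₁ʲū₂ʲe^{r_j} − 1‖ ≤ 4α₃ + 4464α₃²` for `u₁, u₂ ∈ Λ_k(U₀, α₃)`, unitary level backgrounds, `L ≥ 2`, `0 ≤ η`, `L^kη ≤ 1`,
`0 ≤ α₃ ≤ 1/3000` (the constants are those of `B7Prop8Flat.cond166_mul`, Banach reading (a)). [cite: Balaban1985Averaging, (175) p.45, (173) p.45, (166) p.44] -/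
theorem cond166_mul (hV : ∀ j < k, ∀ (x : Site d) (κ : Fin d), ((avgIter L U₀ j x κ : 𝔸ˣ) : 𝔸) ∈ unitary 𝔸)
    (hL : 2 ≤ L) (hη : 0 ≤ η) (hk : (L : ℝ) ^ k * η ≤ 1) (hα0 : 0 ≤ α₃) (hα : α₃ ≤ 1 / 3000)
    (h₁ : InLambda L U₀ u₁ k α₃ η) (h₂ : InLambda L U₀ u₂ k α₃ η) :
    Cond166 L U₀ (u₁ * u₂) k (4 * α₃ + 4464 * α₃ ^ 2) := by
  have hL1 : 1 ≤ L := le_trans (by norm_num) hL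
  have ht : α₃ * (L : ℝ) ^ k * η ≤ 1 / 3000 := by
    rw [mul_assoc]; exact (mul_le_of_le_one_right hα0 hk).trans hα
  intro j hj z
  obtain ⟨r, hE, hB⟩ := eq173_general hV hL hη hα0 (hα.trans (by norm_num)) ht h₁ h₂ j hj
  obtain ⟨hj1, -⟩ := pow_eta_le hL1 hη hk hj
  have hb1 : α₃ * (L : ℝ) ^ j * η ≤ α₃ := by
    rw [mul_assoc]; exact mul_le_of_le_one_right hα0 hj1
  have hb0 : 0 ≤ α₃ * (L : ℝ) ^ j * η := by positivity
  have hρ : 2 * 1116 * (α₃ * (L : ℝ) ^ j * η) ^ 2 ≤ 2232 * α₃ ^ 2 := by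
    nlinarith [pow_le_pow_left₀ hb0 hb1 2]
  rw [hE, vprod_apply, Units.val_mul, Units.val_mul, val_expUnit]
  have f1 : 1 + ‖((uavg L U₀ u₁ j z : 𝔸ˣ) : 𝔸) - 1‖ ≤ Real.exp α₃ := by
    linarith [h₁.1 j hj z, Real.add_one_le_exp α₃]
  have f2 : 1 + ‖((uavg L U₀ u₂ j z : 𝔸ˣ) : 𝔸) - 1‖ ≤ Real.exp α₃ := by
    linarith [h₂.1 j hj z, Real.add_one_le_exp α₃]
  have f3 : 1 + ‖exp (r z) - 1‖ ≤ Real.exp (2 * 1116 * (α₃ * (L : ℝ) ^ j * η) ^ 2) := by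
    linarith [B7Transfer.norm_exp_sub_one_le_of_le (r z) (hB z)]
  refine (norm_mul_sub_one_le_exp (one_add_norm_le_exp (norm_mul_sub_one_le_exp f1 f2)) f3).trans ?_
  have := exp_sub_one_le_two_mul_of_le (x := α₃ + α₃ + 2 * 1116 * (α₃ * (L : ℝ) ^ j * η) ^ 2)
    (y := 2 * α₃ + 2232 * α₃ ^ 2) (by positivity) (by linarith) (by nlinarith)
  linarith

/-- **(175), second line, at the background `U₀`** ("`|(R̄₀uʲ)⁻¹(x_{j+1})(R̄ʲ_{0,x_{j+1}}R̄₀uʲ)(x_j) − 1| < 2α₃L^{j+1}η + 4C₃(α₃Lʲη)²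
< (2α₃ + 2C₃α₃²)L^{j+1}η`, thus `u₁u₂ ∈ Λ_k(U₀, 2α₃ + 2C₃α₃²)`"): the (167)-quantity of `u = u₁u₂` at level `j` is, by the
multiplicativity of the rotation (`B7Eq170General.R0fun_vprod`) and (168) (`B7Eq170Flat.eq168_factor`),
`e^{−r_j(y)}·R(ū₂ʲ(y)⁻¹)[ū₁ʲ(y)⁻¹(R̄ʲ_{0,y}ū₁ʲ)(x)]·ū₂ʲ(y)⁻¹(R̄ʲ_{0,y}ū₂ʲ)(x)·e^{(R̄ʲ_{0,y}r_j)(x)}` with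
`‖(R̄ʲ_{0,y}r_j)(x)‖ = ‖r_j(x)‖` (unitary rotation); the Banach bookkeeping of `B7Prop8Flat.cond167_mul` then gives
`‖… − 1‖ ≤ (6α₃ + 8928α₃²)L^{j+1}η`. [cite: Balaban1985Averaging, (175) p.45, (167)–(168) p.44] -/
theorem cond167_mul (hV : ∀ j < k, ∀ (x : Site d) (κ : Fin d), ((avgIter L U₀ j x κ : 𝔸ˣ) : 𝔸) ∈ unitary 𝔸)
    (hL : 2 ≤ L) (hη : 0 ≤ η) (hk : (L : ℝ) ^ k * η ≤ 1) (hα0 : 0 ≤ α₃) (hα : α₃ ≤ 1 / 3000)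
    (h₁ : InLambda L U₀ u₁ k α₃ η) (h₂ : InLambda L U₀ u₂ k α₃ η) :
    Cond167 L U₀ (u₁ * u₂) k (6 * α₃ + 8928 * α₃ ^ 2) η := by
  have hL1 : 1 ≤ L := le_trans (by norm_num) hL
  have ht : α₃ * (L : ℝ) ^ k * η ≤ 1 / 3000 := by
    rw [mul_assoc]; exact (mul_le_of_le_one_right hα0 hk).trans hα
  have h167₁ := (cond167_iff_R0fun L U₀ u₁ k α₃ η).1 h₁.2
  have h167₂ := (cond167_iff_R0fun L U₀ u₂ k α₃ η).1 h₂.2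
  rw [cond167_iff_R0fun]
  intro j hj z r'
  obtain ⟨r, hE, hB⟩ := eq173_general hV hL hη hα0 (hα.trans (by norm_num)) ht h₁ h₂ j hj.le
  obtain ⟨hj1, hsq⟩ := pow_eta_le hL1 hη hk hj.le
  obtain ⟨hj1', -⟩ := pow_eta_le hL1 hη hk (Nat.succ_le_of_lt hj)
  -- abbreviations
  set V : Site d → Fin d → 𝔸ˣ := avgIter L U₀ j with hVdef
  have hVu : ∀ (x : Site d) (κ : Fin d), ((V x κ : 𝔸ˣ) : 𝔸) ∈ unitary 𝔸 := fun x κ => hV j hj x κ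
  set y : Site d := (L : ℤ) • z with hy
  set x : Site d := (L : ℤ) • z + boxVec L r' with hx
  set b : ℝ := α₃ * (L : ℝ) ^ j * η with hb
  set a : ℝ := α₃ * (L : ℝ) ^ (j + 1) * η with ha
  have hb0 : 0 ≤ b := by rw [hb]; positivity
  have ha0 : 0 ≤ a := by rw [ha]; positivity
  have ha1 : a ≤ α₃ := by rw [ha, mul_assoc]; exact mul_le_of_le_one_right hα0 hj1'
  have hb2 : b ^ 2 ≤ α₃ ^ 2 * ((L : ℝ) ^ (j + 1) * η) := by
    rw [hb, mul_assoc, mul_pow]; exact mul_le_mul_of_nonneg_left hsq (sq_nonneg α₃)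
  -- rotate the product and factorise (168)
  set w₁ : Site d → 𝔸ˣ := R0fun V y (uavg L U₀ u₁ j) with hw₁
  set w₂ : Site d → 𝔸ˣ := R0fun V y (uavg L U₀ u₂ j) with hw₂
  set ρ : Site d → 𝔸 := R0lie V y r with hρ
  have hrot : R0fun V y (uavg L U₀ (u₁ * u₂) j) x = vprod w₁ w₂ ρ x := by
    rw [hE, R0fun_vprod]
  have hctr : uavg L U₀ (u₁ * u₂) j y = vprod w₁ w₂ ρ y := by
    rw [hE, hw₁, hw₂, hρ, vprod_R0fun_self]
  rw [hrot, hctr, eq168_factor, Units.val_mul, Units.val_mul, Units.val_mul, val_expUnit, val_expUnit, val_Rc_eq_cj]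
  -- values at the centre
  have hw₁y : w₁ y = uavg L U₀ u₁ j y := by rw [hw₁, R0fun_self]
  have hw₂y : w₂ y = uavg L U₀ u₂ j y := by rw [hw₂, R0fun_self]
  have hρy : ρ y = r y := by rw [hρ, R0lie_self]
  have hρx : ‖ρ x‖ = ‖r x‖ := by rw [hρ, norm_R0lie_of_unitary V hVu]
  -- the four factors
  have hw : ‖(((w₂ y)⁻¹ : 𝔸ˣ) : 𝔸) - 1‖ ≤ 2 / 5 := by
    rw [hw₂y]
    exact (norm_units_inv_sub_one_le _ ((h₂.1 j hj.le y).trans (by linarith))).trans (by linarith [h₂.1 j hj.le y])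
  have hw' : ‖((w₂ y : 𝔸ˣ) : 𝔸) - 1‖ ≤ 2 / 5 := by rw [hw₂y]; exact (h₂.1 j hj.le y).trans (by linarith)
  have f1 : 1 + ‖exp (-ρ y) - 1‖ ≤ Real.exp (2 * 1116 * b ^ 2) := by
    rw [hρy]
    linarith [B7Transfer.norm_exp_sub_one_le_of_le (-r y) ((norm_neg (r y)).le.trans (hB y))]
  have f2 : 1 + ‖cj (w₂ y)⁻¹ ((((w₁ y)⁻¹ * w₁ x : 𝔸ˣ)) : 𝔸) - 1‖ ≤ Real.exp (2 * a) := by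
    rw [cj_sub_one]
    have := norm_cj_le_two_mul hw (by rw [inv_inv]; exact hw') (((((w₁ y)⁻¹ * w₁ x : 𝔸ˣ)) : 𝔸) - 1)
    have h1 : ‖((((w₁ y)⁻¹ * w₁ x : 𝔸ˣ)) : 𝔸) - 1‖ ≤ a := by rw [hw₁y]; exact h167₁ j hj z r'
    linarith [Real.add_one_le_exp (2 * a)]
  have f3 : 1 + ‖((((w₂ y)⁻¹ * w₂ x : 𝔸ˣ)) : 𝔸) - 1‖ ≤ Real.exp a := by
    rw [hw₂y]
    linarith [h167₂ j hj z r', Real.add_one_le_exp a]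
  have f4 : 1 + ‖exp (ρ x) - 1‖ ≤ Real.exp (2 * 1116 * b ^ 2) := by
    linarith [B7Transfer.norm_exp_sub_one_le_of_le (ρ x) (hρx.le.trans (hB x))]
  refine (norm_mul_sub_one_le_exp (one_add_norm_le_exp (norm_mul_sub_one_le_exp
    (one_add_norm_le_exp (norm_mul_sub_one_le_exp f1 f2)) f3)) f4).trans ?_
  have hb2' : b ^ 2 ≤ α₃ ^ 2 := hb2.trans (mul_le_of_le_one_right (sq_nonneg _) hj1')
  have := exp_sub_one_le_two_mul_of_le (x := 2 * 1116 * b ^ 2 + 2 * a + a + 2 * 1116 * b ^ 2)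
    (y := 3 * a + 4464 * b ^ 2) (by positivity) (by linarith) (by nlinarith)
  have hfin : 2 * (3 * a + 4464 * b ^ 2) ≤ (6 * α₃ + 8928 * α₃ ^ 2) * (L : ℝ) ^ (j + 1) * η := by
    rw [ha]; nlinarith
  linarith

/-- **Proposition 8 at a general unitary background, kernel form.** Print (p. 45): "If `u₁, u₂ ∈ Λ_k(U₀, α₃)` and `α₃` is
sufficiently small, i.e., `α₃ ≦ c₆` for some `c₆`, then `u = u₁u₂ ∈ Λ_k(U₀, 2α₃ + 2C₃α₃²)` and we have (173)."  Here: `𝔸` a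
C⋆-algebra, `U₀ : ℤ^d → (Fin d → 𝔸ˣ)` with unitary-valued averaged backgrounds `Ū₀ʲ` (`j < k`), `Λ_k(U₀, ·)` =
`B7Eq167Flat.InLambda L U₀` (`≤` for `<`, free `η` with `L^kη ≤ 1`; print `η = L^{−k}`), `C₃ = 1116`, `L ≥ 2`, `0 ≤ α₃ ≤ 1/3000`
(an admissible `c₆`): `u₁u₂ ∈ Λ_k(U₀, 6α₃ + 8928α₃²)` — print's `2α₃ + 2C₃α₃²` up to the Banach bookkeeping factors of
`B7Prop8Flat` reading (a); (173) is `eq173_general`. [cite: Balaban1985Averaging, Proposition 8 p.45, (166)–(175) pp.44–45] -/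
theorem prop8_general (hV : ∀ j < k, ∀ (x : Site d) (κ : Fin d), ((avgIter L U₀ j x κ : 𝔸ˣ) : 𝔸) ∈ unitary 𝔸)
    (hL : 2 ≤ L) (hη : 0 ≤ η) (hk : (L : ℝ) ^ k * η ≤ 1) (hα0 : 0 ≤ α₃) (hα : α₃ ≤ 1 / 3000)
    (h₁ : InLambda L U₀ u₁ k α₃ η) (h₂ : InLambda L U₀ u₂ k α₃ η) :
    InLambda L U₀ (u₁ * u₂) k (6 * α₃ + 8928 * α₃ ^ 2) η := by
  refine ⟨fun j hj z => (cond166_mul hV hL hη hk hα0 hα h₁ h₂ j hj z).trans (by nlinarith), ?_⟩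
  exact cond167_mul hV hL hη hk hα0 hα h₁ h₂

/-- `prop8_general` with a linear constant: `u₁u₂ ∈ Λ_k(U₀, 10α₃)` for `α₃ ≤ 1/3000`. [cite: Balaban1985Averaging, Proposition 8 p.45] -/
theorem prop8_general' (hV : ∀ j < k, ∀ (x : Site d) (κ : Fin d), ((avgIter L U₀ j x κ : 𝔸ˣ) : 𝔸) ∈ unitary 𝔸)
    (hL : 2 ≤ L) (hη : 0 ≤ η) (hk : (L : ℝ) ^ k * η ≤ 1) (hα0 : 0 ≤ α₃) (hα : α₃ ≤ 1 / 3000)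
    (h₁ : InLambda L U₀ u₁ k α₃ η) (h₂ : InLambda L U₀ u₂ k α₃ η) :
    InLambda L U₀ (u₁ * u₂) k (10 * α₃) η :=
  (prop8_general hV hL hη hk hα0 hα h₁ h₂).mono (by nlinarith) le_rfl (by positivity) hη

/-- **Proposition 8 for a UNITARY background with the regularity (52)**: the unitarity of the averaged backgrounds
`Ū₀ʲ` is then automatic (`B7Prop2Explicit.prop2_unitaryUnits`, Proposition 2's closure statement), so the only hypotheses
left are print's: `U₀` unitary with (52) `|U₀(∂p) − 1| < α₀η²` (`α₀` within Prop. 2's explicit thresholds `C0`, `c2'`),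
`u₁, u₂ ∈ Λ_k(U₀, α₃)`, `α₃ ≤ 1/3000`. [cite: Balaban1985Averaging, Proposition 8 p.45, Proposition 2 (52)–(54) p.26] -/
theorem prop8_unitary [Nontrivial 𝔸] (hL : 2 ≤ L) (hη : 0 ≤ η) (hk : (L : ℝ) ^ k * η ≤ 1) (hα0 : 0 ≤ α₃) (hα : α₃ ≤ 1 / 3000)
    (hU : ∀ (x : Site d) (κ : Fin d), U₀ x κ ∈ unitaryUnits 𝔸)
    {α₀ : ℝ} (hα₀ : 0 < α₀) (hα₀3 : C0 d * α₀ ≤ 1 / 3) (hα₀2 : 2 * α₀ ≤ c2' d L)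
    (h52 : pdev U₀ < α₀ * (((L : ℝ) ^ k)⁻¹) ^ 2)
    (h₁ : InLambda L U₀ u₁ k α₃ η) (h₂ : InLambda L U₀ u₂ k α₃ η) :
    InLambda L U₀ (u₁ * u₂) k (6 * α₃ + 8928 * α₃ ^ 2) η := by
  have hmem := (prop2_unitaryUnits (d := d) L hL k U₀ hU hα₀ hα₀3 hα₀2 h52).2
  exact prop8_general (fun j hj x κ => (mem_unitaryUnits).1 (hmem j hj.le x κ)) hL hη hk hα0 hα h₁ h₂

end Unitary

end Literature.MathematicalPhysics.QuantumFieldTheory.Balaban1983to89.B7Prop8General
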